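import Summits.QuantumFields.YangMills.Theorems.ContractibleFibreFibreToTorusEnergyBoundary
import Literature.MathematicalPhysics.QuantumFieldTheory.Sweep1ShenZhuZhuProofs
import HarnessLib

/-!
# Boundary insensitivity of the perturbed Wilson kernel normaliser (tangent programme, step T2)

Helper for crux `FibreToTorus` (stmt-QuantumFields-16244), line `Sketch`, tangent programme
(Israel's tangent form of the variational principle: differentiability of the perturbed pressure
`λ ↦ p(β, λ A)` at `λ = 0` forces all translation-invariant DLR states to have the same mean of the
local observable `A`, Friedli–Velenik 2017, Prop. 6.91 / Thm. 6.90, for lattice gauge theory).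
Step T2 is the perturbed analogue of the landed step E2
(`energy_abs_logNormaliser_sub_logFree_le`): the kernel normaliser of the Wilson specification
with an extra bounded cylinder perturbation `Φ` supported inside `Λ`,
`N(β, Λ, Φ, η) = ∫ exp(-β S_Λ(ζ η_{Λᶜ}) + Φ(ζ η_{Λᶜ})) dζ`, and the perturbed free partition
function `Z(β, P, Φ) = ∫ exp(-β ∑_{p ∈ P} (N - Re tr ρ(U_p)) + Φ(U)) dg_∞` of a set `P` of
plaquettes touching `Λ` with all edges in `Λ` satisfy
`|log N - log Z| ≤ |β| (N + M) · #(plaquettesTouching Λ \ P)`: the plaquettes outside `P` cost a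
factor `exp(±|β|(N + M))` each, and the remaining fibre integral — including the perturbation,
which is read off the resampled edges only — no longer feels the boundary condition, so that by the
resampling identity for the infinite Haar product it equals `Z(β, P, Φ)`.
-/

noncomputable section

open MeasureTheory Filter Topology Finset
open Literature.Probability.LatticeModels (Site halfOpenBox glueWith)
open Literature.MathematicalPhysics.QuantumLattice (LGConfig ZdEdge ZdPlaquette plaquetteObs plaquetteEdges
  plaquettesTouching wilsonBoundaryAction ymSpecification ymGibbsMeasures IsZdTranslationInvariant
  freeEnergyDensity configShift LocalGaugeObservable IsCylinder)
open Literature.MathematicalPhysics.QuantumFieldTheory (haarProbability zdHaar)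

namespace Summit.QuantumFields.YangMills.Theorems.FibreToTorus

/-- Logarithmic form of a two-sided multiplicative sandwich: if `e^{-c} b ≤ a ≤ e^{c} b` with
`b > 0` then `|log a - log b| ≤ c`. [folklore] -/
private theorem tangent_abs_log_sub_log_le_of_sandwich {a b c : ℝ} (hb : 0 < b)
    (h1 : a ≤ Real.exp c * b) (h2 : Real.exp (-c) * b ≤ a) :
    |Real.log a - Real.log b| ≤ c := by
  have ha : 0 < a := lt_of_lt_of_le (mul_pos (Real.exp_pos _) hb) h2
  have h1' := Real.log_le_log ha h1
  have h2' := Real.log_le_log (mul_pos (Real.exp_pos _) hb) h2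
  rw [Real.log_mul (Real.exp_pos _).ne' hb.ne', Real.log_exp] at h1' h2'
  rw [abs_le]
  constructor <;> linarith

/-- **Boundary insensitivity of the perturbed kernel normaliser** (Friedli–Velenik 2017, proof of
Thm. 3.6 / Prop. 6.91, transcribed to the plaquette interaction with a local perturbation): for
`P ⊆ plaquettesTouching Λ` with all edges of the plaquettes of `P` inside `Λ`, and a bounded
measurable cylinder perturbation `Φ` with support `S ⊆ Λ`,
`|log ∫ e^{-β S_Λ(ζ η_{Λᶜ}) + Φ(ζ η_{Λᶜ})} dζ - log ∫ e^{-β ∑_{p ∈ P}(N - Re tr ρ(U_p)) + Φ(U)} dg_∞|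
  ≤ |β| (N + M) · #(plaquettesTouching Λ \ P)`.
The weight `e^{-β S_Λ}` is the product of the plaquette weights over `plaquettesTouching Λ`; those
outside `P` lie in `[e^{-|β|(N+M)}, e^{|β|(N+M)}]` (`FreeEnergy.boxWeight_le`,
`FreeEnergy.pow_le_boxWeight`), and the fibre integral of the weight of `P` times `e^{Φ}` does not
depend on the boundary condition (the edges of `P` and the support of `Φ` are resampled), hence
equals the perturbed free partition function by the resampling identity
`integral_zdHaar_eq_integral_integral_glueWith`. [cite: FriedliVelenik2017, Ch. 6 §6.9.4, proof of Prop. 6.91 (boundary terms and a local perturbation are a surface-order perturbation of the partition function)] -/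
theorem tangent_abs_logNormaliser_sub_logFree_le : ∀ (d N : ℕ) (G : Type) [Group G] [TopologicalSpace G] [IsTopologicalGroup G] [CompactSpace G] [MeasurableSpace G] [BorelSpace G] [SecondCountableTopology G] (ρ : G →* Matrix (Fin N) (Fin N) ℂ), Continuous ρ → ∀ (M : ℝ), (∀ g : G, |(ρ g).trace.re| ≤ M) → ∀ (Λ : Finset (ZdEdge d)) (P : Finset (ZdPlaquette d)), P ⊆ plaquettesTouching Λ → (∀ p ∈ P, plaquetteEdges p ⊆ Λ) → ∀ (Φ : LGConfig d G → ℝ) (S : Finset (ZdEdge d)), Measurable Φ → (∃ C : ℝ, ∀ U, |Φ U| ≤ C) → IsCylinder Φ S → S ⊆ Λ → ∀ (η : LGConfig d G) (β : ℝ), |Real.log (∫ ζ, Real.exp (-β * wilsonBoundaryAction ρ Λ (glueWith Λ ζ η) + Φ (glueWith Λ ζ η)) ∂(MeasureTheory.Measure.pi fun _ : ↥Λ => haarProbability G)) - Real.log (∫ U, Real.exp (-β * (∑ p ∈ P, ((N : ℝ) - plaquetteObs ρ p.1 p.2.1.1 p.2.1.2 U)) + Φ U) ∂(zdHaar d G))|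 ≤ |β| * (N + M) * #(plaquettesTouching Λ \ P) := by
  intro d N G _ _ _ _ _ _ _ ρ hρ M hM Λ P hP hPΛ Φ S hΦm hΦb hΦS hSΛ η β
  obtain ⟨CΦ, hCΦ⟩ := hΦb
  -- the weight of `P`, the weight of the remaining plaquettes, the full perturbed kernel weight,
  -- the perturbed free weight
  set W : LGConfig d G → ℝ := fun U =>
    ∏ p ∈ P, Real.exp (-β * ((N : ℝ) - plaquetteObs ρ p.1 p.2.1.1 p.2.1.2 U)) with hW
  set V : LGConfig d G → ℝ := fun U => ∏ p ∈ plaquettesTouching Λ \ P,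
    Real.exp (-β * ((N : ℝ) - plaquetteObs ρ p.1 p.2.1.1 p.2.1.2 U)) with hV
  set E : LGConfig d G → ℝ := fun U =>
    Real.exp (-β * wilsonBoundaryAction ρ Λ U + Φ U) with hE
  set I : LGConfig d G → ℝ := fun U =>
    Real.exp (-β * (∑ p ∈ P, ((N : ℝ) - plaquetteObs ρ p.1 p.2.1.1 p.2.1.2 U)) + Φ U) with hI
  set π : Measure (↥Λ → G) := Measure.pi fun _ : ↥Λ => haarProbability G with hπ
  set K : ℝ := |β| * (N + M) with hK
  set r : ℕ := #(plaquettesTouching Λ \ P) with hr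
  -- factorisations of the weights
  have hIW : ∀ U, I U = W U * Real.exp (Φ U) := by
    intro U
    simp only [hI, hW, Finset.mul_sum, Real.exp_add, Real.exp_sum]
  have hsplit : ∀ U, E U = V U * I U := by
    intro U
    rw [hIW]
    simp only [hE, hV, hW, wilsonBoundaryAction, Finset.mul_sum, Real.exp_add, Real.exp_sum]
    rw [← mul_assoc, ← Finset.prod_sdiff hP]
  -- bounds on the weight of the remaining plaquettes
  have hVup : ∀ U, V U ≤ Real.exp K ^ r := fun U =>
    Literature.MathematicalPhysics.QuantumLattice.FreeEnergy.boxWeight_le ρ hM β _ U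
  have hVlow : ∀ U, Real.exp (-K) ^ r ≤ V U := fun U =>
    Literature.MathematicalPhysics.QuantumLattice.FreeEnergy.pow_le_boxWeight ρ hM β _ U
  have hI0 : ∀ U, 0 ≤ I U := fun U => (Real.exp_pos _).le
  -- measurability, bounds, integrability
  have hWc : Continuous W :=
    Literature.MathematicalPhysics.QuantumLattice.FreeEnergy.continuous_boxWeight ρ hρ β P
  have hSc : Continuous (wilsonBoundaryAction (G := G) ρ Λ) :=
    Literature.MathematicalPhysics.QuantumLattice.continuous_wilsonBoundaryAction ρ hρ Λ
  obtain ⟨C, hC⟩ := Literature.MathematicalPhysics.QuantumLattice.exists_bound_of_continuous hWc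
  obtain ⟨B, hB⟩ := Literature.MathematicalPhysics.QuantumLattice.exists_bound_of_continuous hSc
  have hIm : Measurable I := by
    have : I = fun U => W U * Real.exp (Φ U) := funext hIW
    rw [this]
    exact hWc.measurable.mul (Real.measurable_exp.comp hΦm)
  have hEm : Measurable E :=
    Real.measurable_exp.comp ((measurable_const.mul hSc.measurable).add hΦm)
  have hIbd : ∀ U, |I U| ≤ C * Real.exp CΦ := by
    intro U
    rw [hIW, abs_mul, Real.abs_exp]
    exact mul_le_mul (hC U) (Real.exp_le_exp.2 (le_abs_self _ |>.trans (hCΦ U))) (Real.exp_pos _).le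
      ((abs_nonneg _).trans (hC U))
  have hEbd : ∀ U, |E U| ≤ Real.exp (|β| * B + CΦ) := by
    intro U
    rw [hE, Real.abs_exp]
    refine Real.exp_le_exp.2 ((le_abs_self _).trans ((abs_add_le _ _).trans (add_le_add ?_ (hCΦ U))))
    rw [abs_mul, abs_neg]
    exact mul_le_mul_of_nonneg_left (hB U) (abs_nonneg _)
  have hglue : Measurable fun ζ : ↥Λ → G => glueWith Λ ζ η :=
    Literature.Probability.LatticeModels.measurable_glueWith Λ η
  have hIint : Integrable (fun ζ : ↥Λ → G => I (glueWith Λ ζ η)) π :=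
    Literature.MathematicalPhysics.QuantumLattice.integrable_of_bound
      (hIm.comp hglue).aestronglyMeasurable fun ζ => hIbd _
  have hEint : Integrable (fun ζ : ↥Λ → G => E (glueWith Λ ζ η)) π :=
    Literature.MathematicalPhysics.QuantumLattice.integrable_of_bound
      (hEm.comp hglue).aestronglyMeasurable fun ζ => hEbd _
  -- the sandwich for the normaliser
  have hup : (∫ ζ, E (glueWith Λ ζ η) ∂π) ≤ Real.exp K ^ r * ∫ ζ, I (glueWith Λ ζ η) ∂π := by
    rw [← integral_const_mul]
    refine integral_mono hEint (hIint.const_mul _) fun ζ => ?_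
    simp only [hsplit]
    exact mul_le_mul_of_nonneg_right (hVup _) (hI0 _)
  have hlow : Real.exp (-K) ^ r * (∫ ζ, I (glueWith Λ ζ η) ∂π) ≤ ∫ ζ, E (glueWith Λ ζ η) ∂π := by
    rw [← integral_const_mul]
    refine integral_mono (hIint.const_mul _) hEint fun ζ => ?_
    simp only [hsplit]
    exact mul_le_mul_of_nonneg_right (hVlow _) (hI0 _)
  -- the fibre integral of the perturbed weight of `P` does not feel the boundary condition ...
  have hfibre : ∀ (η' : LGConfig d G) (ζ : ↥Λ → G), I (glueWith Λ ζ η') = I (glueWith Λ ζ η) := by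
    intro η' ζ
    have hdep : DependsOn W ↑(P.biUnion plaquetteEdges) :=
      Literature.MathematicalPhysics.QuantumLattice.FreeEnergy.dependsOn_boxWeight ρ β P
    rw [hIW, hIW]
    congr 1
    · refine hdep fun e he => ?_
      obtain ⟨p, hp, hep⟩ := mem_biUnion.1 (mem_coe.1 he)
      have heΛ : e ∈ Λ := hPΛ p hp hep
      rw [Literature.Probability.LatticeModels.glueWith_apply_mem _ _ _ heΛ,
        Literature.Probability.LatticeModels.glueWith_apply_mem _ _ _ heΛ]
    · congr 1
      refine hΦS fun e he => ?_
      have heΛ : e ∈ Λ := hSΛ (mem_coe.1 he)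
      rw [Literature.Probability.LatticeModels.glueWith_apply_mem _ _ _ heΛ,
        Literature.Probability.LatticeModels.glueWith_apply_mem _ _ _ heΛ]
  -- ... hence is the perturbed free partition function (resampling identity for `dg_∞`)
  haveI : IsProbabilityMeasure (zdHaar d G) := by
    unfold zdHaar; infer_instance
  have hIZ : (∫ U, I U ∂(zdHaar d G)) = ∫ ζ, I (glueWith Λ ζ η) ∂π := by
    rw [Literature.MathematicalPhysics.QuantumFieldTheory.integral_zdHaar_eq_integral_integral_glueWith
      Λ hIm hIbd]
    have hfun : (fun η' : LGConfig d G =>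
        ∫ ζ, I (glueWith Λ ζ η') ∂(Measure.pi fun _ : ↥Λ => haarProbability G)) =
        fun _ => ∫ ζ, I (glueWith Λ ζ η) ∂π := by
      funext η'
      exact integral_congr_ae (ae_of_all _ fun ζ => hfibre η' ζ)
    rw [hfun, integral_const, probReal_univ, one_smul]
  have hZ0 : 0 < ∫ U, I U ∂(zdHaar d G) :=
    integral_exp_pos (Literature.MathematicalPhysics.QuantumLattice.integrable_of_bound
      hIm.aestronglyMeasurable hIbd)
  -- logarithms
  rw [hIZ] at hZ0
  have hmain := tangent_abs_log_sub_log_le_of_sandwich (a := ∫ ζ, E (glueWith Λ ζ η) ∂π)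
    (c := r * K) hZ0
    (by rw [Real.exp_nat_mul]; exact hup) (by rw [neg_mul_eq_mul_neg, Real.exp_nat_mul]; exact hlow)
  calc |Real.log (∫ ζ, E (glueWith Λ ζ η) ∂π) - Real.log (∫ U, I U ∂(zdHaar d G))|
      = |Real.log (∫ ζ, E (glueWith Λ ζ η) ∂π) - Real.log (∫ ζ, I (glueWith Λ ζ η) ∂π)| := by
        rw [hIZ]
    _ ≤ (r : ℝ) * K := hmain
    _ = K * r := mul_comm _ _

end Summit.QuantumFields.YangMills.Theorems.FibreToTorus
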